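/-
Copyright (c) 2026 the pub-hodgecm-mathlib formalisation cell (harness21).  Prover seat hodgecm-mathlib-F0P3a-p02 (g19): LH3 «Transf» road,
brick (GLUE-X-gen-DENSE) (self-served 2026-09-02 07:12Z on the LH3 board for F0P3a-p09 (g5)'s corner points).
-/
import Literature.Analysis.Calculus.SmoothGluingAcrossHyperplaneRay
import HarnessLib

/-!
# Smooth gluing across a hyperplane — agreement on a DENSE part of the wall suffices

Third file of the `SmoothGluingAcrossHyperplane` kit (everything PROVED; no definition, no named fact, no `sorry`).  In ★
`contDiffOn_extendFrom_of_oneSidedLimits_eq` the two one-sided limits of every jet `Dⁿf` were asked to agree at EVERY wall point.  For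
orbital-integral families the jump data (Harish-Chandra (I₃), A. Bouaziz, *Intégrales orbitales sur les groupes de Lie réductifs*, Ann.
Sci. ÉNS 27 (1994), §3.2 p. 580; D. Shelstad, Compositio Math. 39 (1979), §4 Prop. 4.5 p. 26) are only available at the SEMIREGULAR
points of a wall — those lying on no other wall — which form a dense open part of it.  This file proves that this is enough:
`contDiffOn_extendFrom_of_oneSidedLimits_eq_of_dense` asks the agreement only on a set `D` with `U ∩ {ℓ = a} ⊆ closure (D ∩ {ℓ = a})`.
MECHANISM: under the bounded-jets hypothesis each jet is Lipschitz on the two open half-balls at a wall point, so its one-sided limit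
fields `q₊ = extendFrom (half-ball₊) Dⁿf`, `q₋` are CONTINUOUS on the wall part of the ball (`continuousOn_extendFrom`); they agree on
the dense part `D`, hence on the whole wall part (`Set.EqOn.of_subset_closure`), and the proof of the main file goes through verbatim.
Ray forms (the agreement read off one transversal `v`, tested on words ∕ basis words, only at the points of `D`):
`contDiffOn_extendFrom_of_tendsto_iteratedFDeriv_ray_apply_of_dense`, `…_ray_basis_of_dense`.  These are the inputs of the ITERATION
over several walls (corner points: glue wall by wall, the earlier walls' points being off the dense semiregular part of the later ones).

## References
* A. Bouaziz, *Intégrales orbitales sur les groupes de Lie réductifs*, Ann. Sci. ÉNS (4) 27 (1994), §3.2 (I₁)–(I₃) pp. 579–580.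
* D. Shelstad, *Characters and inner forms of a quasi-split group over `ℝ`*, Compositio Math. 39 (1979), §4 pp. 22–31.
-/

noncomputable section

open Set Filter Metric Function
open scoped Topology NNReal ContDiff

namespace Literature.Analysis.Calculus

variable {E : Type*} [NormedAddCommGroup E] [NormedSpace ℝ E]
  {F : Type*} [NormedAddCommGroup F] [NormedSpace ℝ F] [CompleteSpace F]

section Dense

variable (ℓ : E →L[ℝ] ℝ) (a : ℝ)

/-- **SMOOTH GLUING ACROSS A HYPERPLANE — AGREEMENT ON A DENSE PART OF THE WALL SUFFICES (limit form).**  As ★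
`contDiffOn_extendFrom_of_oneSidedLimits_eq` (`U` open, `s := U ∩ {ℓ ≠ a}`, `f` `C^∞` on `s`, every `Dⁿf` bounded on `s` near each wall point),
but the agreement of the two one-sided limits of `Dⁿf` is asked only at the points of a set `D` whose trace on the wall is DENSE in the wall
(`U ∩ {ℓ = a} ⊆ closure (D ∩ {ℓ = a})` — e.g. the semiregular points, off the other walls).  Reason: the one-sided limit fields are
`extendFrom` of LIPSCHITZ fields, hence continuous along the wall, so agreement propagates from `D` to every wall point
(`Set.EqOn.of_subset_closure`).  Then `extendFrom s f` is `C^∞` on `U`. [cite: Bouaziz1994IntegralesOrbitales, §3.2 (I₁)–(I₂) p. 579] -/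
theorem contDiffOn_extendFrom_of_oneSidedLimits_eq_of_dense {v : E} (hv : ℓ v ≠ 0) {U : Set E} (hU : IsOpen U) {f : E → F}
    (hf : ContDiffOn ℝ ∞ f (U ∩ {y | ℓ y ≠ a}))
    (hb : ∀ x ∈ U, ℓ x = a → ∀ n : ℕ, ∃ C : ℝ, ∀ᶠ y in 𝓝 x, ℓ y ≠ a → ‖iteratedFDeriv ℝ n f y‖ ≤ C)
    {D : Set E} (hD : U ∩ {y | ℓ y = a} ⊆ closure (D ∩ {y | ℓ y = a}))
    (hagree : ∀ x ∈ D, x ∈ U → ℓ x = a → ∀ (n : ℕ) (l₁ l₂ : E [×n]→L[ℝ] F),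
      Tendsto (iteratedFDeriv ℝ n f) (𝓝[{y | a < ℓ y}] x) (𝓝 l₁) →
      Tendsto (iteratedFDeriv ℝ n f) (𝓝[{y | ℓ y < a}] x) (𝓝 l₂) → l₁ = l₂) :
    ContDiffOn ℝ ∞ (extendFrom (U ∩ {y | ℓ y ≠ a}) f) U := by
  -- WLOG the transversal direction points to the side `{a < ℓ}`
  obtain ⟨v, hv⟩ : ∃ v' : E, 0 < ℓ v' := by
    rcases lt_or_gt_of_ne hv with h | h
    · exact ⟨-v, by simpa using h⟩
    · exact ⟨v, h⟩
  set s : Set E := U ∩ {y | ℓ y ≠ a} with hsdef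
  have hs : IsOpen s := hU.inter (isOpen_setOf_apply_ne ℓ a)
  -- the glue agrees with `f` on `s`
  have hgs : EqOn (extendFrom s f) f s := fun y hy => extendFrom_extends hf.continuousOn y hy
  -- plain iterated derivatives of `f` are continuous on the open set `s` and differentiate each other
  have hcontf : ∀ m : ℕ, ContinuousOn (iteratedFDeriv ℝ m f) s := fun m =>
    (hf.continuousOn_iteratedFDerivWithin (m := m) (by exact_mod_cast le_top) hs.uniqueDiffOn).congr
      fun z hz => (iteratedFDerivWithin_of_isOpen m hs hz).symm
  have hp : HasFTaylorSeriesUpToOn ∞ f (ftaylorSeriesWithin ℝ f s) s := hf.ftaylorSeriesWithin hs.uniqueDiffOn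
  have hderf : ∀ (m : ℕ), ∀ y ∈ s, HasFDerivAt (iteratedFDeriv ℝ m f) (iteratedFDeriv ℝ (m + 1) f y).curryLeft y := by
    intro m y hy
    have h1 := hp.fderivWithin m (by exact_mod_cast ENat.coe_lt_top m) y hy
    have h2 : HasFDerivWithinAt (iteratedFDeriv ℝ m f) (iteratedFDerivWithin ℝ (m + 1) f s y).curryLeft s y :=
      h1.congr (fun z hz => (iteratedFDerivWithin_of_isOpen m hs hz).symm) (iteratedFDerivWithin_of_isOpen m hs hy).symm
    rw [iteratedFDerivWithin_of_isOpen (m + 1) hs hy] at h2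
    exact h2.hasFDerivAt (hs.mem_nhds hy)
  -- it is `C^N` near every point, for every finite `N`
  rw [contDiffOn_infty]
  intro N
  refine contDiffOn_of_locally_contDiffOn fun x hxU => ?_
  by_cases hxa : ℓ x ≠ a
  · -- off the wall: the glue is `f` on the open set `s`
    refine ⟨s, hs, ⟨hxU, hxa⟩, ?_⟩
    exact ((hf.of_le (by exact_mod_cast le_top)).congr hgs).mono inter_subset_right
  push Not at hxa
  -- at a wall point: a ball `B ⊆ U` on which the jets of orders `≤ N+1` are bounded off the wall
  obtain ⟨C, hC⟩ : ∃ C : Fin (N + 2) → ℝ, ∀ i : Fin (N + 2), ∀ᶠ y in 𝓝 x, ℓ y ≠ a → ‖iteratedFDeriv ℝ i f y‖ ≤ C i := by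
    choose C hC using fun i : Fin (N + 2) => hb x hxU hxa i
    exact ⟨C, hC⟩
  have hev : ∀ᶠ y in 𝓝 x, y ∈ U ∧ ∀ i : Fin (N + 2), ℓ y ≠ a → ‖iteratedFDeriv ℝ i f y‖ ≤ C i :=
    (hU.eventually_mem hxU).and (eventually_all.2 hC)
  obtain ⟨r, hr, hB⟩ := Metric.eventually_nhds_iff_ball.1 hev
  set B : Set E := ball x r with hBdef
  have hBU : B ⊆ U := fun y hy => (hB y hy).1
  have hBo : IsOpen B := isOpen_ball
  have hxB : x ∈ B := mem_ball_self hr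
  have hbound : ∀ (m : ℕ) (hm : m ≤ N + 1), ∀ y ∈ B, ℓ y ≠ a → ‖iteratedFDeriv ℝ m f y‖ ≤ C ⟨m, by omega⟩ :=
    fun m hm y hy hya => (hB y hy).2 ⟨m, by omega⟩ hya
  -- the two open half-balls
  set Ap : Set E := B ∩ {y | a < ℓ y} with hApdef
  set Am : Set E := B ∩ {y | ℓ y < a} with hAmdef
  have hAps : Ap ⊆ s := fun y hy => ⟨hBU hy.1, ne_of_gt hy.2⟩
  have hAms : Am ⊆ s := fun y hy => ⟨hBU hy.1, ne_of_lt hy.2⟩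
  have hApc : Convex ℝ Ap := (convex_ball x r).inter (convex_setOf_lt_apply ℓ a)
  have hAmc : Convex ℝ Am := (convex_ball x r).inter (convex_setOf_apply_lt ℓ a)
  have hBs : B ∩ s = Ap ∪ Am := by
    ext y; constructor
    · rintro ⟨hyB, -, hya⟩
      rcases lt_or_gt_of_ne hya with h | h
      · exact Or.inr ⟨hyB, h⟩
      · exact Or.inl ⟨hyB, h⟩
    · rintro (⟨hyB, h⟩ | ⟨hyB, h⟩)
      · exact ⟨hyB, hBU hyB, ne_of_gt h⟩
      · exact ⟨hyB, hBU hyB, ne_of_lt h⟩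
  -- one-sided limits of the jets of orders `≤ N` exist at the points of the closures of the half-balls
  have hlimp : ∀ m : ℕ, m ≤ N → ∀ y ∈ closure Ap, ∃ l, Tendsto (iteratedFDeriv ℝ m f) (𝓝[Ap] y) (𝓝 l) :=
    fun m hm y hy => exists_tendsto_iteratedFDeriv_of_bound hs hApc hAps hf
      (fun z hz => hbound (m + 1) (by omega) z hz.1 (ne_of_gt hz.2)) hy
  have hlimm : ∀ m : ℕ, m ≤ N → ∀ y ∈ closure Am, ∃ l, Tendsto (iteratedFDeriv ℝ m f) (𝓝[Am] y) (𝓝 l) :=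
    fun m hm y hy => exists_tendsto_iteratedFDeriv_of_bound hs hAmc hAms hf
      (fun z hz => hbound (m + 1) (by omega) z hz.1 (ne_of_lt hz.2)) hy
  -- the wall part of `B` lies in the closure of both half-balls
  have hWp : B ∩ {y | ℓ y = a} ⊆ closure Ap := fun z hz => mem_closure_inter_lt_apply hz.2 hv (hBo.mem_nhds hz.1)
  have hWm : B ∩ {y | ℓ y = a} ⊆ closure Am := fun z hz => mem_closure_inter_apply_lt hz.2 hv (hBo.mem_nhds hz.1)
  -- and `D` is dense in it
  have hDense : B ∩ {y | ℓ y = a} ⊆ closure (D ∩ (B ∩ {y | ℓ y = a})) := by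
    intro z hz
    have h1 : z ∈ closure (D ∩ {y | ℓ y = a}) := hD ⟨hBU hz.1, hz.2⟩
    have h3 : z ∈ closure (B ∩ (D ∩ {y | ℓ y = a})) := hBo.inter_closure ⟨hz.1, h1⟩
    have hsub : B ∩ (D ∩ {y | ℓ y = a}) ⊆ D ∩ (B ∩ {y | ℓ y = a}) := fun u hu => ⟨hu.2.1, hu.1, hu.2.2⟩
    exact closure_mono hsub h3
  -- hence limits WITHIN `s` at every point of `B`: at the wall points the two one-sided limit FIELDS are continuous along the wall
  -- and agree on the dense part `D`, so they agree everywhere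
  have hlim : ∀ m : ℕ, m ≤ N → ∀ y ∈ B, ∃ l, Tendsto (iteratedFDeriv ℝ m f) (𝓝[s] y) (𝓝 l) := by
    intro m hm y hyB
    by_cases hya : ℓ y ≠ a
    · exact ⟨_, hcontf m y ⟨hBU hyB, hya⟩⟩
    push Not at hya
    set qp : E → E [×m]→L[ℝ] F := extendFrom Ap (iteratedFDeriv ℝ m f) with hqpdef
    set qm : E → E [×m]→L[ℝ] F := extendFrom Am (iteratedFDeriv ℝ m f) with hqmdef
    have hqp_cont : ContinuousOn qp (B ∩ {y | ℓ y = a}) := continuousOn_extendFrom hWp fun z hz => hlimp m hm z (hWp hz)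
    have hqm_cont : ContinuousOn qm (B ∩ {y | ℓ y = a}) := continuousOn_extendFrom hWm fun z hz => hlimm m hm z (hWm hz)
    have hEqD : EqOn qp qm (D ∩ (B ∩ {y | ℓ y = a})) := by
      rintro z ⟨hzD, hzB, hza⟩
      have t₁ : Tendsto (iteratedFDeriv ℝ m f) (𝓝[Ap] z) (𝓝 (qp z)) := tendsto_extendFrom (hlimp m hm z (hWp ⟨hzB, hza⟩))
      have t₂ : Tendsto (iteratedFDeriv ℝ m f) (𝓝[Am] z) (𝓝 (qm z)) := tendsto_extendFrom (hlimm m hm z (hWm ⟨hzB, hza⟩))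
      have e₁ : 𝓝[Ap] z = 𝓝[{y | a < ℓ y}] z := nhdsWithin_inter_eq_of_isOpen hBo hzB
      have e₂ : 𝓝[Am] z = 𝓝[{y | ℓ y < a}] z := nhdsWithin_inter_eq_of_isOpen hBo hzB
      exact hagree z hzD (hBU hzB) hza m (qp z) (qm z) (e₁ ▸ t₁) (e₂ ▸ t₂)
    have hEq : EqOn qp qm (B ∩ {y | ℓ y = a}) := hEqD.of_subset_closure hqp_cont hqm_cont inter_subset_right hDense
    have hl₁ : Tendsto (iteratedFDeriv ℝ m f) (𝓝[Ap] y) (𝓝 (qp y)) := tendsto_extendFrom (hlimp m hm y (hWp ⟨hyB, hya⟩))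
    have hl₂ : Tendsto (iteratedFDeriv ℝ m f) (𝓝[Am] y) (𝓝 (qm y)) := tendsto_extendFrom (hlimm m hm y (hWm ⟨hyB, hya⟩))
    rw [hEq ⟨hyB, hya⟩] at hl₁
    refine ⟨qm y, ?_⟩
    rw [← nhdsWithin_inter_eq_of_isOpen hBo hyB (A := s), hBs, nhdsWithin_union]
    exact tendsto_sup.2 ⟨hl₁, hl₂⟩
  -- the glued jets `q`
  set q : E → FormalMultilinearSeries ℝ E F := fun y m => extendFrom s (iteratedFDeriv ℝ m f) y with hqdef
  have hq_tend : ∀ m : ℕ, m ≤ N → ∀ y ∈ B, Tendsto (iteratedFDeriv ℝ m f) (𝓝[s] y) (𝓝 (q y m)) :=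
    fun m hm y hy => tendsto_extendFrom (hlim m hm y hy)
  have hBcl : B ⊆ closure s := by
    intro y hy
    have h1 := subset_closure_union_closure (a := a) hv hBo hy
    rcases h1 with h | h
    · exact closure_mono hAps h
    · exact closure_mono hAms h
  have hq_eq : ∀ m : ℕ, ∀ y ∈ s, q y m = iteratedFDeriv ℝ m f y :=
    fun m y hy => extendFrom_eq (subset_closure hy) (hcontf m y hy)
  have hq_cont : ∀ m : ℕ, m ≤ N → ContinuousOn (q · m) B :=
    fun m hm => continuousOn_extendFrom hBcl (hlim m hm)
  have hq_ev : ∀ m : ℕ, ∀ y ∈ s, (fun z => q z m) =ᶠ[𝓝 y] iteratedFDeriv ℝ m f :=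
    fun m y hy => Filter.eventually_of_mem (hs.mem_nhds hy) fun z hz => hq_eq m z hz
  have hderq_s : ∀ m : ℕ, ∀ y ∈ s, HasFDerivAt (q · m) (iteratedFDeriv ℝ (m + 1) f y).curryLeft y :=
    fun m y hys => (hderf m y hys).congr_of_eventuallyEq (hq_ev m y hys)
  -- the glued jets differentiate each other on `B` (orders `< N`)
  have hderq : ∀ m : ℕ, m < N → ∀ y ∈ B, HasFDerivWithinAt (q · m) (q y (m + 1)).curryLeft B y := by
    intro m hm y hyB
    by_cases hya : ℓ y ≠ a
    · have hys : y ∈ s := ⟨hBU hyB, hya⟩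
      have h1 := hderq_s m y hys
      rw [← hq_eq (m + 1) y hys] at h1
      exact h1.hasFDerivWithinAt
    push Not at hya
    -- a smaller ball whose closure stays in `B`
    obtain ⟨δ, hδ, hδB⟩ : ∃ δ > 0, closedBall y δ ⊆ B := by
      obtain ⟨δ, hδ, h⟩ := Metric.mem_nhds_iff.1 (hBo.mem_nhds hyB)
      exact ⟨δ / 2, half_pos hδ, (closedBall_subset_ball (half_lt_self hδ)).trans h⟩
    -- the one-derivative boundary lemma on each open half of the small ball
    have hstep : ∀ (A : Set E), Convex ℝ A → IsOpen A → A ⊆ s → closure A ⊆ B →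
        HasFDerivWithinAt (q · m) (q y (m + 1)).curryLeft (closure A) y := by
      intro A hAc hAo hAs' hAB
      refine hasFDerivWithinAt_closure_of_tendsto_fderiv ?_ hAc hAo ?_ ?_
      · exact fun z hz => (hderq_s m z (hAs' hz)).differentiableAt.differentiableWithinAt
      · exact fun z hz => ((hq_cont m hm.le) z (hAB hz)).mono (subset_closure.trans hAB)
      · have h1 : ∀ z ∈ A, fderiv ℝ (fun w => q w m) z = (iteratedFDeriv ℝ (m + 1) f z).curryLeft :=
          fun z hz => (hderq_s m z (hAs' hz)).fderiv
        have h2 : Tendsto (fun z => (iteratedFDeriv ℝ (m + 1) f z).curryLeft) (𝓝[A] y)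
            (𝓝 (q y (m + 1)).curryLeft) :=
          ((continuousMultilinearCurryLeftEquiv ℝ (fun _ : Fin (m + 1) => E) F).continuous.tendsto _).comp
            ((hq_tend (m + 1) (by omega) y hyB).mono_left (nhdsWithin_mono _ hAs'))
        exact h2.congr' (eventually_of_mem self_mem_nhdsWithin fun z hz => (h1 z hz).symm)
    have hb' : ball y δ ⊆ B := ball_subset_closedBall.trans hδB
    have hcl : ∀ A' : Set E, closure (ball y δ ∩ A') ⊆ B := fun A' =>
      ((closure_mono inter_subset_left).trans closure_ball_subset_closedBall).trans hδB
    have h₁ := hstep (ball y δ ∩ {z | a < ℓ z}) ((convex_ball y δ).inter (convex_setOf_lt_apply ℓ a))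
      (isOpen_ball.inter (isOpen_setOf_lt_apply ℓ a)) (fun z hz => ⟨hBU (hb' hz.1), ne_of_gt hz.2⟩) (hcl _)
    have h₂ := hstep (ball y δ ∩ {z | ℓ z < a}) ((convex_ball y δ).inter (convex_setOf_apply_lt ℓ a))
      (isOpen_ball.inter (isOpen_setOf_apply_lt ℓ a)) (fun z hz => ⟨hBU (hb' hz.1), ne_of_lt hz.2⟩) (hcl _)
    have h₃ : HasFDerivWithinAt (q · m) (q y (m + 1)).curryLeft (ball y δ) y :=
      (h₁.union h₂).mono (subset_closure_union_closure (a := a) hv isOpen_ball)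
    exact (h₃.hasFDerivAt (ball_mem_nhds y hδ)).hasFDerivWithinAt
  -- so `q` is a Taylor series, up to order `N`, of `y ↦ (q y 0).curry0` on `B`
  have hQ : HasFTaylorSeriesUpToOn N (fun y => (q y 0).curry0) q B := by
    refine ⟨fun y _ => rfl, fun m hm y hy => hderq m (by exact_mod_cast hm) y hy, fun m hm => hq_cont m (by exact_mod_cast hm)⟩
  -- and that function is the glue on `B`
  have hgB : EqOn (extendFrom s f) (fun y => (q y 0).curry0) B := by
    intro y hyB
    refine extendFrom_eq (hBcl hyB) ?_
    have h1 : Tendsto (fun z => (iteratedFDeriv ℝ 0 f z).curry0) (𝓝[s] y) (𝓝 (q y 0).curry0) :=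
      ((continuousMultilinearCurryFin0 ℝ E F).continuous.tendsto _).comp (hq_tend 0 (Nat.zero_le _) y hyB)
    exact h1.congr' (eventually_of_mem self_mem_nhdsWithin fun z _ => iteratedFDeriv_zero_apply (𝕜 := ℝ) _)
  refine ⟨B, hBo, hxB, ?_⟩
  exact (hQ.contDiffOn.congr hgB).mono inter_subset_right


/-- **DENSE RAY FORM, tested on words.**  As ★ `contDiffOn_extendFrom_of_tendsto_iteratedFDeriv_ray_apply`, with the ray agreement
asked only at the points of `D` (dense trace on the wall). [cite: Bouaziz1994IntegralesOrbitales, §3.2 (I₁)–(I₂) p. 579] -/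
theorem contDiffOn_extendFrom_of_tendsto_iteratedFDeriv_ray_apply_of_dense {v : E} (hv : ℓ v ≠ 0) {U : Set E} (hU : IsOpen U)
    {f : E → F} (hf : ContDiffOn ℝ ∞ f (U ∩ {y | ℓ y ≠ a}))
    (hb : ∀ x ∈ U, ℓ x = a → ∀ n : ℕ, ∃ C : ℝ, ∀ᶠ y in 𝓝 x, ℓ y ≠ a → ‖iteratedFDeriv ℝ n f y‖ ≤ C)
    {D : Set E} (hD : U ∩ {y | ℓ y = a} ⊆ closure (D ∩ {y | ℓ y = a}))
    (hj : ∀ x ∈ D, x ∈ U → ℓ x = a → ∀ (n : ℕ) (m : Fin n → E), ∃ l : F,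
      Tendsto (fun t : ℝ => iteratedFDeriv ℝ n f (x + t • v) m) (𝓝[>] 0) (𝓝 l) ∧
      Tendsto (fun t : ℝ => iteratedFDeriv ℝ n f (x + t • v) m) (𝓝[<] 0) (𝓝 l)) :
    ContDiffOn ℝ ∞ (extendFrom (U ∩ {y | ℓ y ≠ a}) f) U := by
  refine contDiffOn_extendFrom_of_oneSidedLimits_eq_of_dense ℓ a hv hU hf hb hD fun x hxD hxU hxa n l₁ l₂ h₁ h₂ => ?_
  -- WLOG `0 < ℓ v` (replace `v` by `-v`)
  obtain ⟨w, hw, hjw⟩ : ∃ w : E, 0 < ℓ w ∧ ∀ m : Fin n → E, ∃ l : F,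
      Tendsto (fun t : ℝ => iteratedFDeriv ℝ n f (x + t • w) m) (𝓝[>] 0) (𝓝 l) ∧
      Tendsto (fun t : ℝ => iteratedFDeriv ℝ n f (x + t • w) m) (𝓝[<] 0) (𝓝 l) := by
    rcases lt_or_gt_of_ne hv with hneg | hpos
    · refine ⟨-v, by simpa using hneg, fun m => ?_⟩
      obtain ⟨l, hlp, hlm⟩ := hj x hxD hxU hxa n m
      refine ⟨l, (tendsto_ray_neg_iff (fun y => iteratedFDeriv ℝ n f y m) x v _).2 hlm, ?_⟩
      exact (tendsto_ray_neg_iff (fun y => iteratedFDeriv ℝ n f y m) x (-v) (𝓝 l)).1 (by simpa using hlp)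
    · exact ⟨v, hpos, hj x hxD hxU hxa n⟩
  have r₁ : Tendsto (fun t : ℝ => x + t • w) (𝓝[>] 0) (𝓝[{y | a < ℓ y}] x) := by
    simpa [univ_inter] using tendsto_ray_nhdsWithin_lt_apply hxa hw univ_mem
  have r₂ : Tendsto (fun t : ℝ => x + t • w) (𝓝[<] 0) (𝓝[{y | ℓ y < a}] x) := by
    simpa [univ_inter] using tendsto_ray_nhdsWithin_apply_lt hxa hw univ_mem
  ext m
  obtain ⟨l, hlp, hlm⟩ := hjw m
  have ev : Continuous fun L : E [×n]→L[ℝ] F => L m := (ContinuousMultilinearMap.apply ℝ (fun _ : Fin n => E) F m).continuous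
  have e₁ : l₁ m = l := tendsto_nhds_unique ((ev.tendsto l₁).comp (h₁.comp r₁)) hlp
  have e₂ : l₂ m = l := tendsto_nhds_unique ((ev.tendsto l₂).comp (h₂.comp r₂)) hlm
  rw [e₁, e₂]

/-- **DENSE RAY FORM, tested on basis words.** [cite: Bouaziz1994IntegralesOrbitales, §3.2 (I₁)–(I₂) p. 579] -/
theorem contDiffOn_extendFrom_of_tendsto_iteratedFDeriv_ray_basis_of_dense {ι : Type*} (b : Module.Basis ι ℝ E) {v : E}
    (hv : ℓ v ≠ 0) {U : Set E} (hU : IsOpen U) {f : E → F} (hf : ContDiffOn ℝ ∞ f (U ∩ {y | ℓ y ≠ a}))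
    (hb : ∀ x ∈ U, ℓ x = a → ∀ n : ℕ, ∃ C : ℝ, ∀ᶠ y in 𝓝 x, ℓ y ≠ a → ‖iteratedFDeriv ℝ n f y‖ ≤ C)
    {D : Set E} (hD : U ∩ {y | ℓ y = a} ⊆ closure (D ∩ {y | ℓ y = a}))
    (hj : ∀ x ∈ D, x ∈ U → ℓ x = a → ∀ (n : ℕ) (k : Fin n → ι), ∃ l : F,
      Tendsto (fun t : ℝ => iteratedFDeriv ℝ n f (x + t • v) fun i => b (k i)) (𝓝[>] 0) (𝓝 l) ∧
      Tendsto (fun t : ℝ => iteratedFDeriv ℝ n f (x + t • v) fun i => b (k i)) (𝓝[<] 0) (𝓝 l)) :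
    ContDiffOn ℝ ∞ (extendFrom (U ∩ {y | ℓ y ≠ a}) f) U := by
  refine contDiffOn_extendFrom_of_oneSidedLimits_eq_of_dense ℓ a hv hU hf hb hD fun x hxD hxU hxa n l₁ l₂ h₁ h₂ => ?_
  obtain ⟨w, hw, hjw⟩ : ∃ w : E, 0 < ℓ w ∧ ∀ k : Fin n → ι, ∃ l : F,
      Tendsto (fun t : ℝ => iteratedFDeriv ℝ n f (x + t • w) fun i => b (k i)) (𝓝[>] 0) (𝓝 l) ∧
      Tendsto (fun t : ℝ => iteratedFDeriv ℝ n f (x + t • w) fun i => b (k i)) (𝓝[<] 0) (𝓝 l) := by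
    rcases lt_or_gt_of_ne hv with hneg | hpos
    · refine ⟨-v, by simpa using hneg, fun k => ?_⟩
      obtain ⟨l, hlp, hlm⟩ := hj x hxD hxU hxa n k
      refine ⟨l, (tendsto_ray_neg_iff (fun y => iteratedFDeriv ℝ n f y fun i => b (k i)) x v _).2 hlm, ?_⟩
      exact (tendsto_ray_neg_iff (fun y => iteratedFDeriv ℝ n f y fun i => b (k i)) x (-v) (𝓝 l)).1 (by simpa using hlp)
    · exact ⟨v, hpos, hj x hxD hxU hxa n⟩
  have r₁ : Tendsto (fun t : ℝ => x + t • w) (𝓝[>] 0) (𝓝[{y | a < ℓ y}] x) := by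
    simpa [univ_inter] using tendsto_ray_nhdsWithin_lt_apply hxa hw univ_mem
  have r₂ : Tendsto (fun t : ℝ => x + t • w) (𝓝[<] 0) (𝓝[{y | ℓ y < a}] x) := by
    simpa [univ_inter] using tendsto_ray_nhdsWithin_apply_lt hxa hw univ_mem
  apply ContinuousMultilinearMap.toMultilinearMap_injective
  refine Module.Basis.ext_multilinear (fun _ : Fin n => b) fun k => ?_
  obtain ⟨l, hlp, hlm⟩ := hjw k
  have ev : Continuous fun L : E [×n]→L[ℝ] F => L fun i => b (k i) :=
    (ContinuousMultilinearMap.apply ℝ (fun _ : Fin n => E) F fun i => b (k i)).continuous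
  have e₁ : l₁ (fun i => b (k i)) = l := tendsto_nhds_unique ((ev.tendsto l₁).comp (h₁.comp r₁)) hlp
  have e₂ : l₂ (fun i => b (k i)) = l := tendsto_nhds_unique ((ev.tendsto l₂).comp (h₂.comp r₂)) hlm
  change l₁ (fun i => b (k i)) = l₂ fun i => b (k i)
  rw [e₁, e₂]

end Dense

end Literature.Analysis.Calculus
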